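/-
Copyright (c) 2026 the pub-hodgecm-mathlib formalisation cell (harness21).  Prover seat hodgecm-mathlib-LH7-p10 (g3), req620 Track A «(D-RAM) FOUR-FRAME» squad
((β₂) road (R-36) «PURE-CELL LEDGER», β₂ sub-dealer LH4-p04 (g10) 🃏«GO» 03:09:15Z «LH7-p10: START F4-RamM», LANEC-RAY-PROGRAM.v1 file G4: the LANE-GENERIC re-issue of
★ W2 `…UpperRayCellLetters.exists_cellLetters` on SIZE TOKENS), helper lane on h413 = stmt-HodgeConjecture-24833 (count-neutral).  2026-09-05.
-/
import Summits.HodgeConjecture.HodgeConjecture.Theorems.F0P3cDyRamUpperLineCellCentre              -- ★ p864286 (LH4-p19 (g3), F3): centre ∕ slope identities, Eisenstein approximation; brings ★ DEFS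
import Summits.HodgeConjecture.HodgeConjecture.Theorems.F0P3cDyRamDiagonalCellCleanRegime          -- ★ (LH4-p19): `v_map_le_pow_iff` (transport of depth bounds along `jE` from `hjv`)
import Summits.HodgeConjecture.HodgeConjecture.Theorems.F0P3cDyRamBoundaryCellLetterCardTwo        -- ★ (LH4 lineage): `v_map_eq_one_iff`, `v_map_eq_map_pow_iff` (exact transport along `jE` from `hjv`)
import Literature.NumberTheory.LocalFields.WildQuadraticDatumNormSignConductor                     -- ★ Lit: brings `v_eq_one_of_v_mul_map_eq_one`, `IsRamifiedQuadraticDatum`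
import HarnessLib

/-!
# Crux `H413`, line LH4 «(D-RAM) FOUR-FRAME» — the (β₂) road (R-36), (OFF) ∕ (OFF_C) residues, RAY bands, BOTH lanes: «THE CELL LETTERS OF AN UPPER-LINE RAY ∩ LOW CELL,
# FROM SIZE TOKENS» — given the reference pair `κ₀, ξ₀` with `|κ₀| ≤ |ξ₀| = |κ_c|` (`κ_c = ρμ∕(ρμ − μ)`) and `|μ| = |jEϖ|^{mE}`, the centre `W`, the slope `B`, and `σ`-fixed `γ₁, W₁`
# with the SLOPE letter, the ROOT letter and the digit sizes of ★ W2 — with `mE` for `m` and NO `|jE a| = |a|`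

Cell `hodgecm-mathlib` (D-0151), FLOOR 0, crux item H413 = `stmt-HodgeConjecture-24833`, route of record `HCCMUnconditional`; squads F0∕P3c∕LH4 ∕ LH7; lane
`--supports stmt-HodgeConjecture-24833 --as helper` (count-neutral; pays NO tier-0 row).  THEOREMS ONLY (no `def`, no instance, no notation, no `sorry`, default heartbeats);
★-only imports; states NO law; (β₂) stays a HYPOTHESIS.  Frame = the opened block letters common to ‹OFF.letter.v2› (lane B) and ‹OFF_C.letter.v2› (lane C): the E-datum,
the `jE`-letters WITHOUT `|jE a| = |a|` (only `hjv : |jE c| ≤ 1 ↔ |c| ≤ 1`, `Fix ρ = jE(E)`, `Θ∘jE = jE∘σ`), `ρ`, `Θ`, the line model's `lam` (`Θlam·lam = 1`, `|lam| = 1`,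
`lam² = tr·lam − det`, `ρlam = tr − lam`, `det·σdet = 1`, `|lam − 1| ≤ |jEϖ|^{3d−2}`), the `u`-entry (`uσu = 1`, `|u| = 1`), and — instead of ★ W2's lane-B tokens `|μ| = e^{−m}`,
`|μ − ρμ| = e^{−jl}`, `j = b + 2n`, `j + m = jl + b`, `|ξ₀| = e^{2n}`, `|κ₀| ≤ 1` — the two SIZE TOKENS `|μ| = |jEϖ|^{mE}` and `|κ_c| = |ξ₀|` with `|κ₀| ≤ |ξ₀|`, and the cell
inequalities in E-units: `mE < 2b`, RAY `m⋆ + b ≤ mE`, LOW `m_c + 2b ≤ 2mE` (`m⋆ = d%2 + 2d − 1`, `m_c = 3d − 2 + d%2`, spelled out).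

WHY (LANEC-RAY-PROGRAM.v1 §0–§1, G4; consumer: the lane-C RAY worker G7 and — unchanged — lane B's ★ p864702).  In lane B the tokens hold with `mE = m` (`|jEϖ| = e^{−1}`,
`|κ_c| = e^{jl−m} = e^{2n} = |ξ₀|`); in lane C (`|jE a| = |a|²`, `|jEϖ| = e^{−2}`, `m = 2mE` by ★ `depth_even_ramM`) they hold with `|κ_c| = e^{jl−m} = e^{2d′+4n} = |ξ₀|` on the
generic branch `j = b + s0 + 2n` of the top line `jl + 2b = 2j + d_ρ + m` (★ G1 `exists_refPair_ramM` ∕ `refPair_cell_sizes`).  The proof is ★ W2's with every use of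
`|jE a| = |a|` replaced by transport along `jE` from `hjv` (★ `v_map_le_pow_iff`, ★ `v_map_eq_one_iff`, ★ `v_map_eq_map_pow_iff`): `|det − 1| ≤ |ϖ|^{3d−2}` from
`|jE det − 1| = |lam·ρlam − 1| ≤ |jEϖ|^{3d−2}`; `|B| = |ϖ|^{mE}` from `|jE B| = |(μ − ρμ)ξ₀| = |μ|` (★ F3 `v_skew_mul_centre_defect` with `|κ_c| = |ξ₀|`); `|W − σW| = |ϖ|^{mE}` from
`jE(W − σW)·ξ₀ = κ_c − Θκ_c = −κ_c·μ∕jE u` (★ F3).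
* HEAD `exists_cellLetters_of_tokens` — `∃ W B γ₁ W₁` with: `jE W·ξ₀ = κ_c − κ₀`; `jE B = (μ − ρμ)ξ₀`; `σγ₁ = γ₁`, `σW₁ = W₁`; SLOPE `|B∕(P·t₊) − γ₁| ≤ |γ₁|·|ϖ|^{2d−1}`; ROOT
  `|γ₁(W − W₁)| ≤ |ϖ|^{2d−1}`; `|γ₁|·|ϖ|^b = |ϖ|^{mE−b−d%2}`; `1 ≤ |γ₁|`; `|γ₁|·|ϖ|^b ≤ |ϖ|^{2d−1}`; `|ϖ|^{2d−2} ≤ |γ₁|·|ϖ|^{2d−1}`; `|W₁| ≤ 1` (`P = (ϖσϖ)^b`,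
  `t₊ = (ϖ − σϖ)·((ϖσϖ)^{(d−d%2)∕2})⁻¹`).
HONEST LABEL.  Count-neutral algebra; nothing printed is asserted; no census law is stated; the RAY bands of both lanes stay as they are on the ledger; `HC_CM` is proved only modulo
the 7 printed citations (2 remaining named inputs: hLiu418 = `stmt-HodgeConjecture-24832`, h413 = `stmt-HodgeConjecture-24833`) until rung 0 closes.
## References
* [Kottwitz1986BaseChangeUnits] R. E. Kottwitz, *Base change for unit elements of Hecke algebras*, Compositio Math. 60 (1986): §3 (the cell constants of a cone cell).
* [Serre1979] J.-P. Serre, *Local Fields*, GTM 67 (1979): Ch. III §6 Prop. 12 (Eisenstein coordinates), Ch. V §3, Ch. XV §2.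
* [Rogawski1990] J. D. Rogawski, *Automorphic Representations of Unitary Groups in Three Variables*, Ann. of Math. Stud. 123 (1990): §4.9 Prop. 4.9.1 (b) p. 55, §12.2.
* [Jacobowitz1962] R. Jacobowitz, *Hermitian forms over local fields*, Amer. J. Math. 84 (1962): §4.
-/

set_option autoImplicit false

noncomputable section

namespace Summit.HodgeConjecture.HodgeConjecture.Cruxes.H413.F0P3cDyRamUpperRayCellLettersGen

open scoped Valued WithZero
open WithZero
open Literature.NumberTheory.Automorphic.UnitaryThreeFourFrame (IsRamifiedQuadraticDatum)
open Literature.NumberTheory.LocalFields.WildQuadraticDatum (v_eq_one_of_v_mul_map_eq_one)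
open Literature.NumberTheory.Rogawski1990
open Summit.HodgeConjecture.HodgeConjecture.Cruxes.H413.F0P3cDyRamToricCensusDefs
open Summit.HodgeConjecture.HodgeConjecture.Cruxes.H413.F0P3cDyRamUpperLineCellCentre
open Summit.HodgeConjecture.HodgeConjecture.Cruxes.H413.F0P3cDyRamDiagonalCellCleanRegime (v_map_le_pow_iff)
open Summit.HodgeConjecture.HodgeConjecture.Cruxes.H413.F0P3cDyRamBoundaryCellLetterCardTwo (v_map_eq_one_iff v_map_eq_map_pow_iff)

variable {E M : Type} [Field E] [Valued E ℤᵐ⁰] [Field M] [Valued M ℤᵐ⁰] {ρ Θ : M →+* M}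

/-- **HEAD — «THE CELL LETTERS OF AN UPPER-LINE RAY ∩ LOW CELL, FROM SIZE TOKENS» (both lanes).**  See the module docstring for the frame and the list; `μ = lam − jE u`,
`κ_c = ρμ∕(ρμ − μ)`, `P = (ϖσϖ)^b`, `t₊ = (ϖ − σϖ)·((ϖσϖ)^{(d−d%2)∕2})⁻¹`.  Tokens: `|μ| = |jEϖ|^{mE}`, `|κ_c| = |ξ₀|`, `|κ₀| ≤ |ξ₀|`.  Outputs `W B γ₁ W₁ : E` with:
`jE W·ξ₀ = κ_c − κ₀`; `jE B = (μ − ρμ)·ξ₀`; `σγ₁ = γ₁`; `σW₁ = W₁`; `|B∕(P·t₊) − γ₁| ≤ |γ₁|·|ϖ|^{2d−1}`; `|γ₁(W − W₁)| ≤ |ϖ|^{2d−1}`; `|γ₁|·|ϖ|^b = |ϖ|^{mE−b−d%2}`; `1 ≤ |γ₁|`;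
`|γ₁|·|ϖ|^b ≤ |ϖ|^{2d−1}`; `|ϖ|^{2d−2} ≤ |γ₁|·|ϖ|^{2d−1}`; `|W₁| ≤ 1`.
[cite: Kottwitz1986BaseChangeUnits, §3] [cite: Serre1979, Ch. III §6 Prop. 12; Ch. XV §2] [cite: Rogawski1990, §4.9 Prop. 4.9.1 (b) p. 55] -/
theorem exists_cellLetters_of_tokens {σ : E →+* E} {ϖ : E} {d tE : ℕ} (hD : IsRamifiedQuadraticDatum σ ϖ d tE)
    (jE : E →+* M) (hjv : ∀ c, Valued.v (jE c) ≤ 1 ↔ Valued.v c ≤ 1) (hjfix : ∀ z, ρ z = z ↔ ∃ c, jE c = z) (hΘj : ∀ c, Θ (jE c) = jE (σ c))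
    (hρρ : ∀ x, ρ (ρ x) = x) (hvρ : ∀ x, Valued.v (ρ x) = Valued.v x) (hΘρ : ∀ x, Θ (ρ x) = ρ (Θ x))
    {lam : M} (hΘlam : Θ lam * lam = 1) (hvlam : Valued.v lam = 1)
    {tr det : E} (hdet : det * σ det = 1) (hlam2 : lam * lam = jE tr * lam - jE det) (hρlam : ρ lam = jE tr - lam)
    (hlam3 : Valued.v (lam - 1) ≤ Valued.v (jE ϖ) ^ (3 * d - 2))
    {u : E} (huu : u * σ u = 1) (hu : Valued.v u = 1)
    {mE : ℕ} (hμv : Valued.v (lam - jE u) = Valued.v (jE ϖ) ^ mE) (hμρ : ρ (lam - jE u) ≠ lam - jE u)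
    {b : ℕ} (h2bm : mE < 2 * b) (hray : d % 2 + 2 * d - 1 + b ≤ mE) (hlow : 3 * d - 2 + d % 2 + 2 * b ≤ 2 * mE)
    {κ₀ ξ₀ : M} (hκ₀ : κ₀ + ρ κ₀ = 1) (hΘκ₀ : Θ κ₀ = κ₀) (hξ : ρ ξ₀ = -ξ₀) (hΘξ : Θ ξ₀ = ξ₀) (hξ0 : ξ₀ ≠ 0)
    (hκ₀v : Valued.v κ₀ ≤ Valued.v ξ₀) (hκc : Valued.v (ρ (lam - jE u) / (ρ (lam - jE u) - (lam - jE u))) = Valued.v ξ₀) :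
    ∃ W BE γ₁ W₁ : E,
      jE W * ξ₀ = ρ (lam - jE u) / (ρ (lam - jE u) - (lam - jE u)) - κ₀ ∧
      jE BE = ((lam - jE u) - ρ (lam - jE u)) * ξ₀ ∧ σ γ₁ = γ₁ ∧ σ W₁ = W₁ ∧
      Valued.v (BE / ((ϖ * σ ϖ) ^ b * ((ϖ - σ ϖ) * ((ϖ * σ ϖ) ^ ((d - d % 2) / 2))⁻¹)) - γ₁) ≤ Valued.v γ₁ * Valued.v ϖ ^ (2 * d - 1) ∧
      Valued.v (γ₁ * (W - W₁)) ≤ Valued.v ϖ ^ (2 * d - 1) ∧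
      Valued.v γ₁ * Valued.v ϖ ^ b = Valued.v ϖ ^ (mE - b - d % 2) ∧ 1 ≤ Valued.v γ₁ ∧
      Valued.v γ₁ * Valued.v ϖ ^ b ≤ Valued.v ϖ ^ (2 * d - 1) ∧ Valued.v ϖ ^ (2 * d - 2) ≤ Valued.v γ₁ * Valued.v ϖ ^ (2 * d - 1) ∧
      Valued.v W₁ ≤ 1 := by
  obtain ⟨hσσ, hvσ, hϖ, -, hd, hd1, -⟩ := id hD
  have hvϖ0 : Valued.v ϖ ≠ 0 := by rw [hϖ]; exact exp_ne_zero
  have hϖ0 : ϖ ≠ 0 := fun h0 => hvϖ0 (by rw [h0, map_zero])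
  have hϖpos : (0 : ℤᵐ⁰) < Valued.v ϖ := zero_lt_iff.2 hvϖ0
  have hϖlt : Valued.v ϖ < 1 := by rw [hϖ, ← exp_zero, exp_lt_exp]; norm_num
  have hσϖ0 : σ ϖ ≠ 0 := (map_ne_zero σ).2 hϖ0
  have hPnE : ∀ k : ℕ, Valued.v ϖ ^ k = exp (-(k : ℤ)) := fun k => by rw [hϖ, ← exp_nsmul]; congr 1; simp
  have hρj : ∀ c : E, ρ (jE c) = jE c := fun c => (hjfix _).2 ⟨c, rfl⟩
  have hϖσ : σ ϖ ≠ ϖ := fun h => by rw [h, sub_self, map_zero] at hd; exact pow_ne_zero _ hvϖ0 hd.symm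
  have hξpos : (0 : ℤᵐ⁰) < Valued.v ξ₀ := zero_lt_iff.2 ((Valuation.ne_zero_iff _).2 hξ0)
  have hju : Valued.v (jE u) = 1 := (v_map_eq_one_iff jE hjv u).2 hu
  -- the multiplier's size is positive
  have hμpos : (0 : ℤᵐ⁰) < Valued.v (lam - jE u) := by
    rw [hμv]; exact pow_pos (zero_lt_iff.2 ((Valuation.ne_zero_iff _).2 ((map_ne_zero jE).2 hϖ0))) _
  -- the centre coordinate and the slope
  obtain ⟨W, hWc⟩ := exists_centre_coord jE hjfix hρρ hμρ hκ₀ hξ hξ0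
  have hρB : ρ (((lam - jE u) - ρ (lam - jE u)) * ξ₀) = ((lam - jE u) - ρ (lam - jE u)) * ξ₀ := by
    rw [map_mul, map_sub, hρρ, hξ]; ring
  obtain ⟨BE, hBE⟩ := (hjfix _).1 hρB
  -- determinant letters
  have hdetv : Valued.v det = 1 := v_eq_one_of_v_mul_map_eq_one hvσ (by rw [hdet]; exact map_one _)
  have hdet0 : det ≠ 0 := fun h0 => by rw [h0, map_zero] at hdetv; exact zero_ne_one hdetv
  have hll : lam * ρ lam = jE det := by
    have e : lam * ρ lam = jE tr * lam - lam * lam := by rw [hρlam]; ring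
    rw [e, hlam2]; ring
  have hdet1 : Valued.v (det - 1) ≤ Valued.v ϖ ^ (3 * d - 2) := by
    refine (v_map_le_pow_iff jE hjv hϖ0 (det - 1) (3 * d - 2)).1 ?_
    rw [map_sub, map_one, ← hll]
    have e : lam * ρ lam - 1 = (lam - 1) * ρ lam + ρ (lam - 1) := by rw [map_sub, map_one]; ring
    rw [e]
    refine (Valuation.map_add _ _ _).trans (max_le ?_ ?_)
    · rw [Valuation.map_mul, hvρ, hvlam, mul_one]; exact hlam3
    · rw [hvρ]; exact hlam3
  -- `σ` of the slope: `σB = −B ∕ det`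
  have hσBE : σ BE = -BE / det := jE.injective (by
    rw [← hΘj, map_div₀, map_neg, hBE, map_mul, hΘξ, ← hll, map_skew_eq_neg_div σ jE hΘj hρj hΘρ hΘlam huu]
    field_simp)
  set P : E := (ϖ * σ ϖ) ^ b with hPdef
  set tp : E := (ϖ - σ ϖ) * ((ϖ * σ ϖ) ^ ((d - d % 2) / 2))⁻¹ with htpdef
  have hσP : σ P = P := by rw [hPdef, map_pow, map_mul, hσσ, mul_comm (σ ϖ) ϖ]
  have hσtp : σ tp = -tp := by
    rw [htpdef, map_mul, map_inv₀, map_pow, map_mul, map_sub, hσσ, mul_comm (σ ϖ) ϖ]; ring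
  have hP0 : P ≠ 0 := pow_ne_zero _ (mul_ne_zero hϖ0 hσϖ0)
  have hPv : Valued.v P = Valued.v ϖ ^ (2 * b) := by rw [hPdef, Valuation.map_pow, Valuation.map_mul, hvσ, ← pow_two, ← pow_mul]
  have htpv : Valued.v tp = Valued.v ϖ ^ (d % 2) := by
    have h1 : Valued.v tp * Valued.v ϖ ^ (2 * ((d - d % 2) / 2)) = Valued.v ϖ ^ d := by
      rw [htpdef, Valuation.map_mul, Valuation.map_inv, Valuation.map_pow, Valuation.map_mul, hvσ, ← pow_two, ← pow_mul, hd,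
        inv_mul_cancel_right₀ (pow_ne_zero _ hvϖ0)]
    have h2 : Valued.v ϖ ^ d = Valued.v ϖ ^ (d % 2) * Valued.v ϖ ^ (2 * ((d - d % 2) / 2)) := by rw [← pow_add]; congr 1; omega
    exact mul_right_cancel₀ (pow_ne_zero _ hvϖ0) (h1.trans h2)
  have htp0 : tp ≠ 0 := fun h0 => by rw [h0, map_zero] at htpv; exact pow_ne_zero _ hvϖ0 htpv.symm
  -- the slope ratio `θ` and its `σ`
  set θ : E := BE / (P * tp) with hθdef
  have hBE0 : BE ≠ 0 := fun h0 => by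
    have : ((lam - jE u) - ρ (lam - jE u)) * ξ₀ = 0 := by rw [← hBE, h0, map_zero]
    exact mul_ne_zero (sub_ne_zero.2 (Ne.symm hμρ)) hξ0 this
  have hθ0 : θ ≠ 0 := div_ne_zero hBE0 (mul_ne_zero hP0 htp0)
  have hθpos : (0 : ℤᵐ⁰) < Valued.v θ := zero_lt_iff.2 ((Valuation.ne_zero_iff _).2 hθ0)
  have hσθ : σ θ = θ / det := by
    rw [hθdef, map_div₀, map_mul, hσBE, hσP, hσtp]; field_simp
  have hθσv : Valued.v (θ - σ θ) ≤ Valued.v θ * Valued.v ϖ ^ (3 * d - 2) := by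
    have e : θ - σ θ = θ * ((det - 1) / det) := by rw [hσθ]; field_simp
    rw [e, Valuation.map_mul, map_div₀ _ (det - 1) det, hdetv, div_one]; exact mul_le_mul' le_rfl hdet1
  -- Eisenstein approximation of the slope ratio
  obtain ⟨γ₁, hσγ, hγ⟩ := exists_fixed_v_sub_mul_eq hσσ hϖσ θ
  have hθγ : Valued.v (θ - γ₁) ≤ Valued.v θ * Valued.v ϖ ^ (2 * d - 1) := by
    have h1 : Valued.v (θ - γ₁) * Valued.v ϖ ^ d ≤ Valued.v θ * Valued.v ϖ ^ (2 * d - 1) * Valued.v ϖ ^ d := by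
      rw [← hd, hγ]
      calc Valued.v (θ - σ θ) * Valued.v ϖ ≤ Valued.v θ * Valued.v ϖ ^ (3 * d - 2) * Valued.v ϖ := mul_le_mul' hθσv le_rfl
        _ = Valued.v θ * Valued.v ϖ ^ (2 * d - 1) * Valued.v (ϖ - σ ϖ) := by
          rw [hd, mul_assoc, mul_assoc, ← pow_succ, ← pow_add]; congr 2; omega
    have h2 := (div_le_iff₀ (pow_pos hϖpos d)).2 h1
    rwa [mul_div_assoc, div_self (pow_ne_zero _ hvϖ0), mul_one] at h2
  have h2d1 : Valued.v ϖ ^ (2 * d - 1) < 1 := pow_lt_one₀ zero_le hϖlt (by omega)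
  have hθlt : Valued.v (θ - γ₁) < Valued.v θ :=
    hθγ.trans_lt (by
      calc Valued.v θ * Valued.v ϖ ^ (2 * d - 1) < Valued.v θ * 1 := mul_lt_mul_of_pos_left h2d1 hθpos
        _ = Valued.v θ := mul_one _)
  have hγv : Valued.v γ₁ = Valued.v θ := by
    have e : γ₁ = θ - (θ - γ₁) := by ring
    rw [e, Valuation.map_sub_eq_of_lt_left _ hθlt]
  -- the size of the slope: `|jE B| = |(μ − ρμ)ξ₀| = |μ|` (★ F3 `v_skew_mul_centre_defect` with `|κ_c| = |ξ₀|`), so `|B| = |ϖ|^{mE}`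
  have hjBv : Valued.v (jE BE) = Valued.v (jE ϖ) ^ mE := by
    have h1 := v_skew_mul_centre_defect hvρ hμρ ξ₀
    rw [hκc, ← hBE, pow_two, mul_assoc, mul_comm (Valued.v (lam - jE u)) (Valued.v ξ₀)] at h1
    rw [← hμv]
    exact mul_right_cancel₀ (mul_ne_zero (ne_of_gt hξpos) (ne_of_gt hμpos)) h1
  have hBEv : Valued.v BE = Valued.v ϖ ^ mE := (v_map_eq_map_pow_iff jE hjv hϖ0 BE mE).1 hjBv
  have hθv : Valued.v θ = exp (2 * (b : ℤ) + (d % 2 : ℕ) - mE) := by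
    rw [hθdef, Valuation.map_div, Valuation.map_mul, hBEv, hPv, htpv, hPnE, hPnE, hPnE, ← exp_add, ← exp_sub]
    congr 1; push_cast; omega
  -- the root: `|W − σW| = |ϖ|^{mE}`, Eisenstein `W₁`
  have hWσ : Valued.v (W - σ W) = Valued.v ϖ ^ mE := by
    refine (v_map_eq_map_pow_iff jE hjv hϖ0 (W - σ W) mE).1 ?_
    have h1 := map_centre_coord_sub σ jE hΘj hΘκ₀ hΘξ hWc
    have h3 : ρ (lam - jE u) / (ρ (lam - jE u) - (lam - jE u)) - Θ (ρ (lam - jE u) / (ρ (lam - jE u) - (lam - jE u))) =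
        -(ρ (lam - jE u) / (ρ (lam - jE u) - (lam - jE u)) * ((lam - jE u) / jE u)) := by
      rw [← neg_sub, map_centre_sub_centre σ jE hΘj hρj hΘρ hΘlam huu hμρ]
    have h2 : Valued.v (jE (W - σ W)) * Valued.v ξ₀ = Valued.v (jE ϖ) ^ mE * Valued.v ξ₀ := by
      rw [← Valuation.map_mul, h1.trans h3, Valuation.map_neg, Valuation.map_mul, hκc, Valuation.map_div, hμv, hju, div_one, mul_comm]
    exact mul_right_cancel₀ (ne_of_gt hξpos) h2
  obtain ⟨W₁, hσW₁, hW1⟩ := exists_fixed_v_sub_mul_eq hσσ hϖσ W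
  have hWWv : Valued.v (W - W₁) = exp (-(mE : ℤ) - 1 + d) := by
    have h1 : Valued.v (W - W₁) * exp (-(d : ℤ)) = exp (-(mE : ℤ) + (-1)) := by rw [← hPnE, ← hd, hW1, hWσ, hPnE, hϖ, exp_add]
    rw [(eq_mul_inv_iff_mul_eq₀ exp_ne_zero).2 h1, ← exp_neg, ← exp_add]; congr 1; ring
  have hWW : Valued.v (γ₁ * (W - W₁)) ≤ Valued.v ϖ ^ (2 * d - 1) := by
    rw [Valuation.map_mul, hγv, hθv, hWWv, ← exp_add, hPnE, exp_le_exp]; push_cast; omega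
  have hWle : Valued.v W ≤ 1 := by
    refine (hjv W).1 ?_
    have h1 : Valued.v (jE W) * Valued.v ξ₀ ≤ 1 * Valued.v ξ₀ := by
      rw [← Valuation.map_mul, hWc, one_mul]
      exact (Valuation.map_sub _ _ _).trans (max_le hκc.le hκ₀v)
    have h2 := (le_div_iff₀ hξpos).2 h1
    rwa [mul_div_assoc, div_self (ne_of_gt hξpos), mul_one] at h2
  have hW₁1 : Valued.v W₁ ≤ 1 := by
    have e : W₁ = W - (W - W₁) := by ring
    rw [e]
    refine (Valuation.map_sub _ _ _).trans (max_le hWle ?_)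
    rw [hWWv, ← exp_zero, exp_le_exp]; omega
  -- the digit sizes
  have hγn : Valued.v γ₁ * Valued.v ϖ ^ b = Valued.v ϖ ^ (mE - b - d % 2) := by
    rw [hγv, hθv, hPnE, hPnE, ← exp_add, exp_inj]; push_cast; omega
  have hγ1 : 1 ≤ Valued.v γ₁ := by rw [hγv, hθv, ← exp_zero, exp_le_exp]; push_cast; omega
  have hγr : Valued.v γ₁ * Valued.v ϖ ^ b ≤ Valued.v ϖ ^ (2 * d - 1) := by
    rw [hγv, hθv, hPnE, hPnE, ← exp_add, exp_le_exp]; push_cast; omega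
  have hγe : Valued.v ϖ ^ (2 * d - 2) ≤ Valued.v γ₁ * Valued.v ϖ ^ (2 * d - 1) := by
    rw [hγv, hθv, hPnE, hPnE, ← exp_add, exp_le_exp]; push_cast; omega
  exact ⟨W, BE, γ₁, W₁, hWc, hBE, hσγ, hσW₁, by rw [hγv]; exact hθγ, hWW, hγn, hγ1, hγr, hγe, hW₁1⟩

end Summit.HodgeConjecture.HodgeConjecture.Cruxes.H413.F0P3cDyRamUpperRayCellLettersGen

end
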